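import Summits.CriticalPhenomena.PercolationContinuityZ3.Theorems.PercNearOneGluingNoHeavyLowerTailSahiGridPatternTwoPayerFourVal

/-!
# `NoHeavyLowerTail` (crux stmt-CriticalPhenomena-4575), Sahi programme P1: **THE TWO-PAYER OR STAR ON THE FOUR-VALUED FAMILY, III — THE HOLE FORM OF CONDITION (N)**

Support file (Sahi cell, seat `prim-sahi-p1`, generation 38; `--supports stmt-CriticalPhenomena-4575`).  Pure proofs, no definitions, no `sorry`, standard axioms.
Continuation of `…SahiGridPatternTwoPayerFourVal` (`twoPayerFourVal_slack_eq`).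

THE MATHEMATICS (seat memo FROM-prim-sahi-p1-gen38-FOUR-VALUED-SURPLUS §2.4).  On the four-valued family `B = (P|P')`, `C = (Q|Q')` (`P ⊆ P'`, `Q ⊆ Q'`) the d-part
`d(P∩Q') + d(P'∩Q) − Θ_V(P×Q) − Θ_V(P'×Q')` of the two-payer slack equals `N_d[P,Q] + N_d[P',Q'] − d(R)`, where `N_d[A,A'] = d(A∩A') − Θ_V(A×A')` are two instances of
condition (N) of the certificate `d` of `V` (both `≥ 0`) and `R = (P'∩Q') ∖ (P∪Q)` is the HOLE (only its part inside `V = supp d` matters).  Hence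
**`twoPayerFourVal_slack_hole`**: `e(B∩C) − Θ_U(B×C) = 4Σ₈ + 4( N_d[P,Q] + N_d[P',Q'] − d(R) )` and **`twoPayerFourVal_N_of_hole`**: condition (N) holds at `(B,C)` as soon as
`d(R) ≤ Σ₈ + N_d[P,Q] + N_d[P',Q']` — "the certificate mass on the hole is at most the surplus plus the two diagonal (N_V)-slacks".  This is the form in which the open
all-`k` statement is posed in the memo (its LP version over certificates is tight at `k = 4`, and needs (T_V)).  Nothing here asserts `PatternPos d` for `d ≥ 4` or condition (N)
beyond the stated hypotheses. [this work]
-/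

namespace Summit.CriticalPhenomena.PercolationContinuityZ3.Theorems.SahiGridPattern

open Finset SahiGrid3
open scoped BigOperators

variable {k : ℕ}

/-- Finset bookkeeping of the hole: for `P ⊆ P'`, `Q ⊆ Q'` and any `d`,
`d(P∩Q') + d(P'∩Q) = d(P∩Q) + d(P'∩Q') − d((P'∩Q') ∖ (P∪Q))`. [this work] -/
theorem sum_fourVal_hole {P P' Q Q' : Finset (Pd k)} (hPP' : P ⊆ P') (hQQ' : Q ⊆ Q') (d : Pd k → ℤ) :
    (∑ q ∈ P ∩ Q', d q) + (∑ q ∈ P' ∩ Q, d q) = (∑ q ∈ P ∩ Q, d q) + (∑ q ∈ P' ∩ Q', d q) - ∑ q ∈ (P' ∩ Q') \ (P ∪ Q), d q := by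
  have hi : (P ∩ Q') ∩ (P' ∩ Q) = P ∩ Q := by
    ext x; simp only [Finset.mem_inter]
    exact ⟨fun h => ⟨h.1.1, h.2.2⟩, fun h => ⟨⟨h.1, hQQ' h.2⟩, ⟨hPP' h.1, h.2⟩⟩⟩
  have hu : (P ∩ Q') ∪ (P' ∩ Q) = (P' ∩ Q') \ ((P' ∩ Q') \ (P ∪ Q)) := by
    ext x; simp only [Finset.mem_inter, Finset.mem_union, Finset.mem_sdiff, not_and, not_not]
    constructor
    · rintro (⟨hP, hQ'⟩ | ⟨hP', hQ⟩)
      · exact ⟨⟨hPP' hP, hQ'⟩, fun _ => Or.inl hP⟩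
      · exact ⟨⟨hP', hQQ' hQ⟩, fun _ => Or.inr hQ⟩
    · rintro ⟨⟨hP', hQ'⟩, h⟩
      rcases h ⟨hP', hQ'⟩ with hP | hQ
      · exact Or.inl ⟨hP, hQ'⟩
      · exact Or.inr ⟨hP', hQ⟩
  have e1 := Finset.sum_union_inter (s₁ := P ∩ Q') (s₂ := P' ∩ Q) (f := d)
  rw [hi, hu] at e1
  have hsub : (P' ∩ Q') \ (P ∪ Q) ⊆ P' ∩ Q' := Finset.sdiff_subset
  have e2 := Finset.sum_sdiff (f := d) hsub
  linarith

section FourValHole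

variable {V P P' Q Q' : Finset (Pd k)} {U B C : Finset (Pd (1 + (1 + k)))}

/-- **The hole form of the slack** on the four-valued family (every `k`; `supp d ⊆ V`, `P ⊆ P'`, `Q ⊆ Q'`):
`e(B∩C) − Θ_U(B×C) = 4Σ₈ + 4( N_d[P,Q] + N_d[P',Q'] − d((P'∩Q') ∖ (P∪Q)) )`. [this work] -/
theorem twoPayerFourVal_slack_hole (hU : ∀ (ξ η : Pd 1) (q : Pd k), glue ξ (glue η q) ∈ U ↔ ((1 ≤ ξ 0 ∧ 1 ≤ η 0) ∨ q ∈ V))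
    (hB : ∀ (ξ η : Pd 1) (q : Pd k), glue ξ (glue η q) ∈ B ↔ ((ξ 0 = 0 ∧ q ∈ P) ∨ (1 ≤ ξ 0 ∧ q ∈ P')))
    (hC : ∀ (ξ η : Pd 1) (q : Pd k), glue ξ (glue η q) ∈ C ↔ ((η 0 = 0 ∧ q ∈ Q) ∨ (1 ≤ η 0 ∧ q ∈ Q')))
    (hPP' : P ⊆ P') (hQQ' : Q ⊆ Q') (d : Pd k → ℤ) (hdV : ∀ q, q ∉ V → d q = 0) :
    (∑ x ∈ B ∩ C, (fun x : Pd (1 + (1 + k)) =>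
        if (1 ≤ freeOf x 0 ∧ 1 ≤ freeOf (cellOf x) 0) then (4 * 2 ^ k + 3 * (2 ^ k * ind V (cellOf (cellOf x)) - (nuCount V (cellOf (cellOf x)) : ℤ)))
        else if (freeOf x 0 = 0 ∧ freeOf (cellOf x) 0 = 0) then 4 * 2 ^ k * ind V (cellOf (cellOf x))
        else (2 * 2 ^ k + 2 * d (cellOf (cellOf x))) * ind V (cellOf (cellOf x))) x) - (∑ x ∈ B, ∑ y ∈ C, thetaVal U x y)
    = 4 * (∑ q : Pd k, ∑ r : Pd k, (if TotDist q r = true then (1:ℤ) else 0) *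
      ( ind P' r * (ind Q' r - ind Q' (thirdPt q r)) + 2 * (ind P' r * (ind Q r * ind V r - ind Q (thirdPt q r) * ind V (thirdPt q r))) + ind P' r * (ind Q' r * ind V r - ind Q' (thirdPt q r) * ind V (thirdPt q r)) + 2 * (ind Q' r * (ind P r * ind V r - ind P (thirdPt q r) * ind V (thirdPt q r))) + ind Q' r * (ind P' r * ind V r - ind P' (thirdPt q r) * ind V (thirdPt q r)) + 3 * ((1 - ind V q) * (ind P' r * (ind Q' r - ind Q' (thirdPt q r)))) + (ind P' q - ind P q) * (ind Q' q - ind Q q) * ind V q + (ind P' q - ind P q) * (ind Q' r - ind Q r) * (1 - ind V (thirdPt q r)) ))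
      + 4 * (((∑ q ∈ P ∩ Q, d q) - (∑ q ∈ P, ∑ r ∈ Q, thetaVal V q r)) + ((∑ q ∈ P' ∩ Q', d q) - (∑ q ∈ P', ∑ r ∈ Q', thetaVal V q r))
             - ∑ q ∈ (P' ∩ Q') \ (P ∪ Q), d q) := by
  have h := twoPayerFourVal_slack_eq hU hB hC d hdV
  have e := sum_fourVal_hole hPP' hQQ' d
  linarith

/-- **(N) from the hole bound** (every `k`): if the certificate mass on the hole `(P'∩Q') ∖ (P∪Q)` is at most `Σ₈ + N_d[P,Q] + N_d[P',Q']`, then condition (N) of the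
two-payer star holds at `(B,C)`.  (With the (N_V) hypothesis both `N_d`-terms are `≥ 0`; routes U, A, D of `…TwoPayerFourValRoutes` are three ways of bounding `d(hole)`.) [this work] -/
theorem twoPayerFourVal_N_of_hole (hU : ∀ (ξ η : Pd 1) (q : Pd k), glue ξ (glue η q) ∈ U ↔ ((1 ≤ ξ 0 ∧ 1 ≤ η 0) ∨ q ∈ V))
    (hB : ∀ (ξ η : Pd 1) (q : Pd k), glue ξ (glue η q) ∈ B ↔ ((ξ 0 = 0 ∧ q ∈ P) ∨ (1 ≤ ξ 0 ∧ q ∈ P')))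
    (hC : ∀ (ξ η : Pd 1) (q : Pd k), glue ξ (glue η q) ∈ C ↔ ((η 0 = 0 ∧ q ∈ Q) ∨ (1 ≤ η 0 ∧ q ∈ Q')))
    (hP : IsUpperSet (P : Set (Pd k))) (hP' : IsUpperSet (P' : Set (Pd k))) (hQ : IsUpperSet (Q : Set (Pd k))) (hQ' : IsUpperSet (Q' : Set (Pd k)))
    (hV : IsUpperSet (V : Set (Pd k))) (hPP' : P ⊆ P') (hQQ' : Q ⊆ Q')
    (d : Pd k → ℤ) (hdV : ∀ q, q ∉ V → d q = 0)
    (hhole : (∑ q ∈ (P' ∩ Q') \ (P ∪ Q), d q)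
      ≤ (∑ q : Pd k, ∑ r : Pd k, (if TotDist q r = true then (1:ℤ) else 0) *
      ( ind P' r * (ind Q' r - ind Q' (thirdPt q r)) + 2 * (ind P' r * (ind Q r * ind V r - ind Q (thirdPt q r) * ind V (thirdPt q r))) + ind P' r * (ind Q' r * ind V r - ind Q' (thirdPt q r) * ind V (thirdPt q r)) + 2 * (ind Q' r * (ind P r * ind V r - ind P (thirdPt q r) * ind V (thirdPt q r))) + ind Q' r * (ind P' r * ind V r - ind P' (thirdPt q r) * ind V (thirdPt q r)) + 3 * ((1 - ind V q) * (ind P' r * (ind Q' r - ind Q' (thirdPt q r)))) + (ind P' q - ind P q) * (ind Q' q - ind Q q) * ind V q + (ind P' q - ind P q) * (ind Q' r - ind Q r) * (1 - ind V (thirdPt q r)) ))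
        + ((∑ q ∈ P ∩ Q, d q) - (∑ q ∈ P, ∑ r ∈ Q, thetaVal V q r)) + ((∑ q ∈ P' ∩ Q', d q) - (∑ q ∈ P', ∑ r ∈ Q', thetaVal V q r))) :
    (∑ x ∈ B, ∑ y ∈ C, thetaVal U x y) ≤ ∑ x ∈ B ∩ C, (fun x : Pd (1 + (1 + k)) =>
        if (1 ≤ freeOf x 0 ∧ 1 ≤ freeOf (cellOf x) 0) then (4 * 2 ^ k + 3 * (2 ^ k * ind V (cellOf (cellOf x)) - (nuCount V (cellOf (cellOf x)) : ℤ)))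
        else if (freeOf x 0 = 0 ∧ freeOf (cellOf x) 0 = 0) then 4 * 2 ^ k * ind V (cellOf (cellOf x))
        else (2 * 2 ^ k + 2 * d (cellOf (cellOf x))) * ind V (cellOf (cellOf x))) x := by
  have h := twoPayerFourVal_slack_hole hU hB hC hPP' hQQ' d hdV
  have hs := twoPayerFourVal_surplus_nonneg hP hP' hQ hQ' hV hPP' hQQ'
  linarith

end FourValHole

end Summit.CriticalPhenomena.PercolationContinuityZ3.Theorems.SahiGridPattern
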